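import Summits.CriticalPhenomena.PercolationContinuityZ3.Theorems.PercNearOneGluingNoHeavyLowerTailKnQuestion8CoefficientwiseRemSPPieces
import HarnessLib

/-!
# THEOREM U3-CLOSURE, series step: the class map of one piece (rows `R1`/`R0`/`N`, complement on `N011·`) — prim-lf-2 gen 69

Support file (`--supports stmt-CriticalPhenomena-4575`, closed), prover `prim-lf-2` (gen 69).  No definitions, no named facts, no sorries; standard axioms.
Memo `prim-lf-2/CW-SP-gen69.md` §4.2 (SERIES).  For ONE piece `(E; x, m)` with rows for `pieceR0`, `pieceR1`, `pieceN` we build the map used on the components of a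
series composition: the `R1`-row on class `R1`, the `R0`-row on `R0`, the `N`-row on `N`, and the complement `E ∖ s` on the self-conjugate class
`M = N011·` (`m ∉ C_x s ∪ C_x(E∖s)`, no target in `C_x s ∩ C_x(E∖s)`, a target `≠ m` in `C_x s ∩ C_m(E∖s)` AND a target in `C_m s ∩ C_x(E∖s)`).  Each class is
mapped into itself with `C_x(E∖s) ⊆ C_x(g s)`, and `g` is injective on the union of the four classes.
* `Coefficientwise.exists_series_classMap`.
[cite: KozmaNitzan2024, Questions 8–9 (§5.5 p. 36) (context: the Question-8 pocket covariance programme)]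
-/

namespace Summit.CriticalPhenomena.PercolationContinuityZ3.Theorems

open Finset Literature.Probability.Percolation

namespace Coefficientwise

variable {ι V : Type*} [DecidableEq ι] (ends : ι → Sym2 V)

open Classical in
/-- **The class map of a piece.**  See the module docstring. [cite: KozmaNitzan2024, Questions 8–9 (§5.5 p. 36) (context)] -/
theorem exists_series_classMap (E : Finset ι) (x m : V) (W : Set V)
    (hA : HasDomRow ends E x (pieceR0 ends E x m W)) (hB : HasDomRow ends E x (pieceR1 ends E x m W)) (hC : HasDomRow ends E x (pieceN ends E x m W)) :
    ∃ g : Finset ι → Finset ι,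
      (∀ s, s ⊆ E →
        (pieceR1 ends E x m W s → (g s ⊆ E ∧ pieceR1 ends E x m W (g s) ∧ openCluster (ends '' (↑(E \ s) : Set ι)) x ⊆ openCluster (ends '' (↑(g s) : Set ι)) x)) ∧
        (pieceR0 ends E x m W s → (g s ⊆ E ∧ pieceR0 ends E x m W (g s) ∧ openCluster (ends '' (↑(E \ s) : Set ι)) x ⊆ openCluster (ends '' (↑(g s) : Set ι)) x)) ∧
        (pieceN ends E x m W s → (g s ⊆ E ∧ pieceN ends E x m W (g s) ∧ openCluster (ends '' (↑(E \ s) : Set ι)) x ⊆ openCluster (ends '' (↑(g s) : Set ι)) x)) ∧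
        ((m ∉ openCluster (ends '' (↑s : Set ι)) x ∧ m ∉ openCluster (ends '' (↑(E \ s) : Set ι)) x ∧
            (∀ w ∈ W, ¬ (w ∈ openCluster (ends '' (↑s : Set ι)) x ∧ w ∈ openCluster (ends '' (↑(E \ s) : Set ι)) x)) ∧
            (∃ w ∈ W, w ≠ m ∧ w ∈ openCluster (ends '' (↑s : Set ι)) x ∧ w ∈ openCluster (ends '' (↑(E \ s) : Set ι)) m) ∧
            (∃ w ∈ W, w ∈ openCluster (ends '' (↑s : Set ι)) m ∧ w ∈ openCluster (ends '' (↑(E \ s) : Set ι)) x)) →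
          (g s ⊆ E ∧
           (m ∉ openCluster (ends '' (↑(g s) : Set ι)) x ∧ m ∉ openCluster (ends '' (↑(E \ g s) : Set ι)) x ∧
            (∀ w ∈ W, ¬ (w ∈ openCluster (ends '' (↑(g s) : Set ι)) x ∧ w ∈ openCluster (ends '' (↑(E \ g s) : Set ι)) x)) ∧
            (∃ w ∈ W, w ≠ m ∧ w ∈ openCluster (ends '' (↑(g s) : Set ι)) x ∧ w ∈ openCluster (ends '' (↑(E \ g s) : Set ι)) m) ∧
            (∃ w ∈ W, w ∈ openCluster (ends '' (↑(g s) : Set ι)) m ∧ w ∈ openCluster (ends '' (↑(E \ g s) : Set ι)) x)) ∧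
           openCluster (ends '' (↑(E \ s) : Set ι)) x ⊆ openCluster (ends '' (↑(g s) : Set ι)) x))) ∧
      (∀ s s', s ⊆ E →
        (pieceR1 ends E x m W s ∨ pieceR0 ends E x m W s ∨ pieceN ends E x m W s ∨
          (m ∉ openCluster (ends '' (↑s : Set ι)) x ∧ m ∉ openCluster (ends '' (↑(E \ s) : Set ι)) x ∧
            (∀ w ∈ W, ¬ (w ∈ openCluster (ends '' (↑s : Set ι)) x ∧ w ∈ openCluster (ends '' (↑(E \ s) : Set ι)) x)) ∧
            (∃ w ∈ W, w ≠ m ∧ w ∈ openCluster (ends '' (↑s : Set ι)) x ∧ w ∈ openCluster (ends '' (↑(E \ s) : Set ι)) m) ∧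
            (∃ w ∈ W, w ∈ openCluster (ends '' (↑s : Set ι)) m ∧ w ∈ openCluster (ends '' (↑(E \ s) : Set ι)) x))) →
        s' ⊆ E →
        (pieceR1 ends E x m W s' ∨ pieceR0 ends E x m W s' ∨ pieceN ends E x m W s' ∨
          (m ∉ openCluster (ends '' (↑s' : Set ι)) x ∧ m ∉ openCluster (ends '' (↑(E \ s') : Set ι)) x ∧
            (∀ w ∈ W, ¬ (w ∈ openCluster (ends '' (↑s' : Set ι)) x ∧ w ∈ openCluster (ends '' (↑(E \ s') : Set ι)) x)) ∧
            (∃ w ∈ W, w ≠ m ∧ w ∈ openCluster (ends '' (↑s' : Set ι)) x ∧ w ∈ openCluster (ends '' (↑(E \ s') : Set ι)) m) ∧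
            (∃ w ∈ W, w ∈ openCluster (ends '' (↑s' : Set ι)) m ∧ w ∈ openCluster (ends '' (↑(E \ s') : Set ι)) x))) →
        g s = g s' → s = s') := by
  obtain ⟨πA, hmA, hiA, hdA⟩ := hA
  obtain ⟨πB, hmB, hiB, hdB⟩ := hB
  obtain ⟨πC, hmC, hiC, hdC⟩ := hC
  set Cx : Finset ι → Set V := fun s => openCluster (ends '' (↑s : Set ι)) x with hCx
  set Cm : Finset ι → Set V := fun s => openCluster (ends '' (↑s : Set ι)) m with hCm
  -- E side
  set a₁ : Finset ι → Prop := fun s => m ∈ Cx s with ha₁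
  set b₁ : Finset ι → Prop := fun s => m ∈ Cx (E \ s) with hb₁
  set NX₁ : Finset ι → Prop := fun s => ∀ w ∈ W, ¬ (w ∈ Cx s ∧ w ∈ Cx (E \ s)) with hNX₁
  set FX₁ : Finset ι → Prop := fun s => ∃ w ∈ W, w ≠ m ∧ w ∈ Cx s ∧ w ∈ Cm (E \ s) with hFX₁     -- f_xh of E (targets ≠ m)
  set HX₁ : Finset ι → Prop := fun s => ∃ w ∈ W, w ∈ Cm s ∧ w ∈ Cx (E \ s) with hHX₁             -- f_hx of E
  -- classes of E in these terms
  have R0₁_iff : ∀ s, pieceR0 ends E x m W s ↔ (a₁ s ∧ ¬ b₁ s ∧ NX₁ s ∧ ¬ FX₁ s) := by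
    intro s; unfold pieceR0
    exact ⟨fun ⟨p, q, r, u⟩ => ⟨p, q, r, fun ⟨w, hw, hne, h1, h2⟩ => u w hw hne ⟨h1, h2⟩⟩,
      fun ⟨p, q, r, u⟩ => ⟨p, q, r, fun w hw hne hh => u ⟨w, hw, hne, hh.1, hh.2⟩⟩⟩
  have R1₁_iff : ∀ s, pieceR1 ends E x m W s ↔ (a₁ s ∧ ¬ b₁ s ∧ NX₁ s ∧ FX₁ s) := by
    intro s; unfold pieceR1; exact Iff.rfl
  have N₁_iff : ∀ s, pieceN ends E x m W s ↔ (¬ a₁ s ∧ ¬ b₁ s ∧ NX₁ s ∧ ¬ HX₁ s ∧ (∃ w ∈ W, w ∈ Cx s ∧ w ∈ Cm (E \ s))) := by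
    intro s; unfold pieceN
    exact ⟨fun ⟨p, q, r, u, v⟩ => ⟨p, q, r, fun ⟨w, hw, h1, h2⟩ => u w hw ⟨h1, h2⟩, v⟩,
      fun ⟨p, q, r, u, v⟩ => ⟨p, q, r, fun w hw hh => u ⟨w, hw, hh.1, hh.2⟩, v⟩⟩
  -- when m ∉ Cx s, the existential flag of pieceN equals FX₁ (the witness cannot be m)
  have FX₁_iff : ∀ s, ¬ a₁ s → ((∃ w ∈ W, w ∈ Cx s ∧ w ∈ Cm (E \ s)) ↔ FX₁ s) := by
    intro s hna
    exact ⟨fun ⟨w, hw, h1, h2⟩ => ⟨w, hw, fun hwm => hna (by simp only [ha₁]; rw [← hwm]; exact h1), h1, h2⟩, fun ⟨w, hw, _, h1, h2⟩ => ⟨w, hw, h1, h2⟩⟩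
  -- D₂ side (terminals m, h)
  set g₁ : Finset ι → Finset ι := fun s => if pieceR1 ends E x m W s then πB s else if pieceR0 ends E x m W s then πA s
      else if pieceN ends E x m W s then πC s else E \ s with hg₁
  set M₁ : Finset ι → Prop := fun s => ¬ a₁ s ∧ ¬ b₁ s ∧ NX₁ s ∧ FX₁ s ∧ HX₁ s with hM₁
  have g₁_R1 : ∀ s, pieceR1 ends E x m W s → g₁ s = πB s := fun s hs => by rw [hg₁]; exact if_pos hs
  have g₁_R0 : ∀ s, pieceR0 ends E x m W s → g₁ s = πA s := by
    intro s hs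
    have hn1 : ¬ pieceR1 ends E x m W s := fun h1 => ((R0₁_iff s).mp hs).2.2.2 ((R1₁_iff s).mp h1).2.2.2
    rw [hg₁]; simp only [if_neg hn1, if_pos hs]
  have g₁_N : ∀ s, pieceN ends E x m W s → g₁ s = πC s := by
    intro s hs
    have hna : ¬ a₁ s := ((N₁_iff s).mp hs).1
    have hn1 : ¬ pieceR1 ends E x m W s := fun h1 => hna ((R1₁_iff s).mp h1).1
    have hn0 : ¬ pieceR0 ends E x m W s := fun h0 => hna ((R0₁_iff s).mp h0).1
    rw [hg₁]; simp only [if_neg hn1, if_neg hn0, if_pos hs]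
  have g₁_M : ∀ s, M₁ s → g₁ s = E \ s := by
    intro s hs
    obtain ⟨hna, -, -, -, hHX⟩ := hs
    have hn1 : ¬ pieceR1 ends E x m W s := fun h1 => hna ((R1₁_iff s).mp h1).1
    have hn0 : ¬ pieceR0 ends E x m W s := fun h0 => hna ((R0₁_iff s).mp h0).1
    have hnN : ¬ pieceN ends E x m W s := fun hN => ((N₁_iff s).mp hN).2.2.2.1 hHX
    rw [hg₁]; simp only [if_neg hn1, if_neg hn0, if_neg hnN]
  have M_compl : ∀ s, s ⊆ E → M₁ s → M₁ (E \ s) := by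
    intro s hs ⟨hna, hnb, hn, ⟨w, hw, hwm, hw1, hw2⟩, ⟨w', hw', hw1', hw2'⟩⟩
    have hss : E \ (E \ s) = s := Finset.sdiff_sdiff_eq_self hs
    refine ⟨hnb, ?_, ?_, ?_, ?_⟩
    · show m ∉ Cx (E \ (E \ s)); rw [hss]; exact hna
    · intro u hu hh; rw [hss] at hh; exact hn u hu ⟨hh.2, hh.1⟩
    · refine ⟨w', hw', fun hwm' => ?_, hw2', ?_⟩
      · exact hnb (by simp only [hb₁]; rw [← hwm']; exact hw2')
      · rw [hss]; exact hw1'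
    · exact ⟨w, hw, hw2, by rw [hss]; exact hw1⟩
  ------------------------------------------------------------------
  have g₁_props : ∀ s, s ⊆ E →
      (pieceR1 ends E x m W s → (g₁ s ⊆ E ∧ pieceR1 ends E x m W (g₁ s) ∧ Cx (E \ s) ⊆ Cx (g₁ s))) ∧
      (pieceR0 ends E x m W s → (g₁ s ⊆ E ∧ pieceR0 ends E x m W (g₁ s) ∧ Cx (E \ s) ⊆ Cx (g₁ s))) ∧
      (pieceN ends E x m W s → (g₁ s ⊆ E ∧ pieceN ends E x m W (g₁ s) ∧ Cx (E \ s) ⊆ Cx (g₁ s))) ∧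
      (M₁ s → (g₁ s ⊆ E ∧ M₁ (g₁ s) ∧ Cx (E \ s) ⊆ Cx (g₁ s))) := by
    intro s hs
    refine ⟨fun hc => ?_, fun hc => ?_, fun hc => ?_, fun hc => ?_⟩
    · rw [g₁_R1 s hc]; exact ⟨(hmB s hs hc).1, (hmB s hs hc).2, hdB s hs hc⟩
    · rw [g₁_R0 s hc]; exact ⟨(hmA s hs hc).1, (hmA s hs hc).2, hdA s hs hc⟩
    · rw [g₁_N s hc]; exact ⟨(hmC s hs hc).1, (hmC s hs hc).2, hdC s hs hc⟩
    · rw [g₁_M s hc]; exact ⟨Finset.sdiff_subset, M_compl s hs hc, le_rfl⟩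
  have dis₁ : ∀ s, (pieceR1 ends E x m W s → ¬ pieceR0 ends E x m W s) ∧ (pieceR1 ends E x m W s → ¬ pieceN ends E x m W s) ∧
      (pieceR1 ends E x m W s → ¬ M₁ s) ∧ (pieceR0 ends E x m W s → ¬ pieceN ends E x m W s) ∧ (pieceR0 ends E x m W s → ¬ M₁ s) ∧
      (pieceN ends E x m W s → ¬ M₁ s) := by
    intro s
    refine ⟨fun h1 h0 => ((R0₁_iff s).mp h0).2.2.2 ((R1₁_iff s).mp h1).2.2.2,
      fun h1 hN => ((N₁_iff s).mp hN).1 ((R1₁_iff s).mp h1).1,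
      fun h1 hM => hM.1 ((R1₁_iff s).mp h1).1,
      fun h0 hN => ((N₁_iff s).mp hN).1 ((R0₁_iff s).mp h0).1,
      fun h0 hM => hM.1 ((R0₁_iff s).mp h0).1,
      fun hN hM => ((N₁_iff s).mp hN).2.2.2.1 hM.2.2.2.2⟩
  set K₁ : Finset ι → Prop := fun s => pieceR1 ends E x m W s ∨ pieceR0 ends E x m W s ∨ pieceN ends E x m W s ∨ M₁ s with hK₁
  have g₁_inj : ∀ s s', s ⊆ E → K₁ s → s' ⊆ E → K₁ s' → g₁ s = g₁ s' → s = s' := by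
    intro s s' hs hk hs' hk' heq
    obtain ⟨d10, d1N, d1M, d0N, d0M, dNM⟩ := dis₁ (g₁ s)
    rcases hk with c | c | c | c <;> rcases hk' with c' | c' | c' | c'
    · exact hiB s s' hs c hs' c' (by rw [← g₁_R1 s c, ← g₁_R1 s' c', heq])
    · exact (d10 ((g₁_props s hs).1 c).2.1 (heq ▸ ((g₁_props s' hs').2.1 c').2.1)).elim
    · exact (d1N ((g₁_props s hs).1 c).2.1 (heq ▸ ((g₁_props s' hs').2.2.1 c').2.1)).elim
    · exact (d1M ((g₁_props s hs).1 c).2.1 (heq ▸ ((g₁_props s' hs').2.2.2 c').2.1)).elim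
    · exact (d10 (heq ▸ ((g₁_props s' hs').1 c').2.1) ((g₁_props s hs).2.1 c).2.1).elim
    · exact hiA s s' hs c hs' c' (by rw [← g₁_R0 s c, ← g₁_R0 s' c', heq])
    · exact (d0N ((g₁_props s hs).2.1 c).2.1 (heq ▸ ((g₁_props s' hs').2.2.1 c').2.1)).elim
    · exact (d0M ((g₁_props s hs).2.1 c).2.1 (heq ▸ ((g₁_props s' hs').2.2.2 c').2.1)).elim
    · exact (d1N (heq ▸ ((g₁_props s' hs').1 c').2.1) ((g₁_props s hs).2.2.1 c).2.1).elim
    · exact (d0N (heq ▸ ((g₁_props s' hs').2.1 c').2.1) ((g₁_props s hs).2.2.1 c).2.1).elim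
    · exact hiC s s' hs c hs' c' (by rw [← g₁_N s c, ← g₁_N s' c', heq])
    · exact (dNM ((g₁_props s hs).2.2.1 c).2.1 (heq ▸ ((g₁_props s' hs').2.2.2 c').2.1)).elim
    · exact (d1M (heq ▸ ((g₁_props s' hs').1 c').2.1) ((g₁_props s hs).2.2.2 c).2.1).elim
    · exact (d0M (heq ▸ ((g₁_props s' hs').2.1 c').2.1) ((g₁_props s hs).2.2.2 c).2.1).elim
    · exact (dNM (heq ▸ ((g₁_props s' hs').2.2.1 c').2.1) ((g₁_props s hs).2.2.2 c).2.1).elim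
    · have e : E \ s = E \ s' := by rw [← g₁_M s c, ← g₁_M s' c', heq]
      rw [← Finset.sdiff_sdiff_eq_self hs, e, Finset.sdiff_sdiff_eq_self hs']
  exact ⟨g₁, fun s hs => ⟨(g₁_props s hs).1, (g₁_props s hs).2.1, (g₁_props s hs).2.2.1, (g₁_props s hs).2.2.2⟩,
    fun s s' hs hk hs' hk' heq => g₁_inj s s' hs hk hs' hk' heq⟩

end Coefficientwise

end Summit.CriticalPhenomena.PercolationContinuityZ3.Theorems
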